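import Literature.Analysis.FluidPDE.ElgindiBoundaryExtension
import Literature.Analysis.FluidPDE.ElgindiSolutionFamily
import Literature.Analysis.FluidPDE.ElgindiGlobalWeightedBounds
import Literature.Analysis.FluidPDE.ElgindiWeightedHardy
import Literature.Analysis.FluidPDE.ElgindiRadialMulHk
import Literature.Analysis.FluidPDE.ElgindiEllipticHkBoundE
import HarnessLib

/-!
# Transfer of Elgindi's a-priori `𝓗⁴` estimate to the Lax–Milgram solution
([Elgindi2021] §7.3 proof of Proposition 7.7, Steps 2–3; Theorem 2)

Topic `Literature/Analysis/FluidPDE`. Support file (proved theorems, no definitions beyond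
abbreviations, no named facts) on the proof path of the named fact
`Literature.Analysis.FluidPDE.Elgindi.ElgindiGhoulMasmoudi2021_stabilityCore`
(`ElgindiStabilityDecomposition.lean`). T. M. Elgindi, Ann. of Math. 194 (2021) =
arXiv:1904.04795, §7.3 (p. 21) and Theorem 2 (p. 8).

For `0 < α ≤ 1/4` and a smooth datum `f` supported inside `R > 0` and orthogonal to `K`, the smooth
representative `Ψ̃` of the weak solution satisfies the a-priori estimate of
`ElgindiEllipticHkBoundE.lean`:
`|∂_θθΨ̃|²_{𝓗⁴} + |αD_RΨ̃|²_{𝓗⁴} + |α²D_R²Ψ̃|²_{𝓗⁴} ≤ 2C₀|f|²_{𝓗⁴}` (`apriori_solution`).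
Proof: `Ψ̃` and all `D_R^jΨ̃` are orthogonal to `K` slice-wise (the energy space is the closure of
`K`-orthogonal graphs); the cut-offs `η_nΨ̃` lie in the a-priori class (`exists_smooth_profile`) with
data `η_nf + [L,η_n]Ψ̃` orthogonal to `K`; the commutator is `O(1/n)` in `𝓗⁴` by the global weighted
bounds, and Fatou passes to the limit on the left.
-/

noncomputable section

open MeasureTheory Set Real Filter Function Finset
open _root_.Topology
open scoped ENNReal InnerProductSpace ContDiff

namespace Literature.Analysis.FluidPDE

namespace Elgindi

/-! ### The up-estimates on the strip -/

/-- **The up-estimates on the strip**: for `g ∈ C^∞(strip)`, `1 ≤ i ≤ 4`, `p ∈ strip`,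
`w²(D_θ^ig)²s^{−γ} ≤ 6400 Σ_{n=1}^{4} w²(∂_θ^ng)²s^{2n−γ}` (`s = sin 2θ`). [folklore] -/
theorem up_le_strip {g : ℝ → ℝ → ℝ} (hg : ContDiffOn ℝ ∞ (uncurry g) strip) (γ : ℝ) {i : ℕ} (hi1 : 1 ≤ i) (hi4 : i ≤ 4)
    {p : ℝ × ℝ} (hp : p ∈ strip) :
    radialWeight p.1 ^ 2 * (Dθ^[i] g) p.1 p.2 ^ 2 * Real.sin (2 * p.2) ^ (-γ) ≤
      6400 * (radialWeight p.1 ^ 2 * dθ g p.1 p.2 ^ 2 * Real.sin (2 * p.2) ^ (2 - γ)) +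
      6400 * (radialWeight p.1 ^ 2 * dθ (dθ g) p.1 p.2 ^ 2 * Real.sin (2 * p.2) ^ (4 - γ)) +
      6400 * (radialWeight p.1 ^ 2 * (dθ^[3] g) p.1 p.2 ^ 2 * Real.sin (2 * p.2) ^ (6 - γ)) +
      6400 * (radialWeight p.1 ^ 2 * (dθ^[4] g) p.1 p.2 ^ 2 * Real.sin (2 * p.2) ^ (8 - γ)) := by
  -- localise to a global smooth function
  obtain ⟨W, gt, hW, hpW, -, hgt, -, -, hEq⟩ := exists_test_eqOn hg isCompact_singleton (singleton_subset_iff.2 hp)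
  have hpW' : p ∈ W := hpW (mem_singleton p)
  have hagree : ∀ q ∈ W, g q.1 q.2 = (fun R θ => gt (R, θ)) q.1 q.2 := fun q hq => (hEq hq).symm
  have hgt4 : ContDiff ℝ 4 (uncurry fun R θ => gt (R, θ)) := by have := contDiff_infty.1 hgt 4; exact this
  have eD : (Dθ^[i] g) p.1 p.2 = (Dθ^[i] fun R θ => gt (R, θ)) p.1 p.2 := iterate_Dθ_congr_open hW hagree i p hpW'
  have ed : ∀ n, (dθ^[n] g) p.1 p.2 = (dθ^[n] fun R θ => gt (R, θ)) p.1 p.2 := fun n => iterate_dθ_congr_open hW hagree n p hpW'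
  have ed1 := ed 1; have ed2 := ed 2; have ed3 := ed 3; have ed4 := ed 4
  simp only [Function.iterate_succ_apply', Function.iterate_zero, id_eq] at ed1 ed2
  rw [eD, ed1, ed2, ed 3, ed 4]
  have s0 : 0 ≤ Real.sin (2 * p.2) := (Real.sin_pos_of_pos_of_lt_pi (by linarith [hp.2.1]) (by linarith [hp.2.2])).le
  have T1 : 0 ≤ radialWeight p.1 ^ 2 * dθ (fun R θ => gt (R, θ)) p.1 p.2 ^ 2 * Real.sin (2 * p.2) ^ (2 - γ) := by positivity
  have T2 : 0 ≤ radialWeight p.1 ^ 2 * dθ (dθ fun R θ => gt (R, θ)) p.1 p.2 ^ 2 * Real.sin (2 * p.2) ^ (4 - γ) := by positivity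
  have T3 : 0 ≤ radialWeight p.1 ^ 2 * (dθ^[3] fun R θ => gt (R, θ)) p.1 p.2 ^ 2 * Real.sin (2 * p.2) ^ (6 - γ) := by positivity
  have T4 : 0 ≤ radialWeight p.1 ^ 2 * (dθ^[4] fun R θ => gt (R, θ)) p.1 p.2 ^ 2 * Real.sin (2 * p.2) ^ (8 - γ) := by positivity
  interval_cases i
  · have := up_one hgt4 γ hp; nlinarith [this]
  · have := up_two hgt4 γ hp; nlinarith [this]
  · have := up_three hgt4 γ hp; nlinarith [this]
  · have := up_four hgt4 γ hp; nlinarith [this]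

/-! ### Orthogonality of the energy space to `K` -/

/-- The test function `n(R)K(θ)κ(θ)` (`κ` the angular cut-off, `= 1` on `[0,π/2]`). [folklore] -/
def nKtest (n : ℝ → ℝ) (p : ℝ × ℝ) : ℝ := n p.1 * (kernelK p.2 * kappaAng p.2)

/-- Continuity of the test function. [folklore] -/
theorem continuous_nKtest {n : ℝ → ℝ} (hn : Continuous n) : Continuous (nKtest n) := by
  have cK : Continuous kernelK := by unfold kernelK; fun_prop
  unfold nKtest
  have cκ : Continuous kappaAng := (contDiff_kappaAng (n := 0)).continuous
  exact (hn.comp continuous_fst).mul ((cK.comp continuous_snd).mul (cκ.comp continuous_snd))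

/-- Compact support of the test function. [folklore] -/
theorem hasCompactSupport_nKtest {n : ℝ → ℝ} (hns : HasCompactSupport n) : HasCompactSupport (nKtest n) := by
  refine HasCompactSupport.of_support_subset_isCompact (hns.isCompact.prod hasCompactSupport_kappaAng.isCompact) fun p hp => ?_
  simp only [nKtest, mem_support, ne_eq, mul_eq_zero, not_or] at hp
  exact ⟨subset_closure hp.1, subset_closure hp.2.2⟩

/-- On the strip the test function is `n(R)K(θ)`. [folklore] -/
theorem nKtest_eq {n : ℝ → ℝ} {p : ℝ × ℝ} (hp : p ∈ strip) : nKtest n p = n p.1 * kernelK p.2 := by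
  unfold nKtest
  rw [kappaAng_eq_one (by linarith [hp.2.1, Real.pi_pos]) (by linarith [hp.2.2, Real.pi_pos]), mul_one]

/-- **Elements of the energy space are orthogonal to `n(R)K(θ)`** for every continuous compactly
supported `n`. [cite: Elgindi2021, §7.1 proof of Proposition 7.1, Step 1 (p. 19 of arXiv:1904.04795)] -/
theorem integral_weakSpace_nK {α : ℝ} {U : E4} (hU : U ∈ weakSpace α) {n : ℝ → ℝ} (hn : Continuous n) (hns : HasCompactSupport n) :
    ∫ p in strip, (U 0 : ℝ × ℝ → ℝ) p * (n p.1 * kernelK p.2) = 0 := by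
  have hφm : MemLp (nKtest n) 2 stripMeasure := memLp_strip_of_continuous (continuous_nKtest hn) (hasCompactSupport_nKtest hns)
  -- the continuous functional `W ↦ ⟪W₀, φ⟫` vanishes on graphs, hence on the energy space
  have hU' : U ∈ closure ((LinearMap.range (graphL α) : Set E4)) := by
    rw [← Submodule.topologicalClosure_coe]; exact hU
  obtain ⟨V, hV, hlim⟩ := mem_closure_iff_seq_limit.1 hU'
  choose χ hχ using fun m => (LinearMap.mem_range.1 (hV m))
  have hVn : ∀ m, V m = graphElt α (χ m) := fun m => by rw [← hχ m]; rfl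
  have hc0 : Continuous fun W : E4 => W 0 := (PiLp.proj 2 (𝕜 := ℝ) (fun _ : Fin 4 => L2Strip) 0).continuous
  have hΛ : Continuous fun W : E4 => ⟪W 0, toL2 (nKtest n)⟫_ℝ := hc0.inner continuous_const
  have hgraph : ∀ m, ⟪V m 0, toL2 (nKtest n)⟫_ℝ = 0 := by
    intro m
    obtain ⟨hsm, hs, -, -, hK⟩ := (χ m).2
    have h1 : ContDiff ℝ 1 (uncurry (χ m : ℝ → ℝ → ℝ)) := hsm 1
    rw [hVn, graphElt_apply, inner_toL2 (memLp_graphFn h1 hs 0) hφm]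
    have e1 : ∫ p in strip, graphFn α (χ m) 0 p * nKtest n p = ∫ p in strip, (fun R θ => Real.cos θ * (χ m : ℝ → ℝ → ℝ) R θ) p.1 p.2 * (n p.1 * kernelK p.2) :=
      setIntegral_congr_fun measurableSet_strip fun p hp => by rw [nKtest_eq hp]; rfl
    rw [e1, integral_strip_mul_radial_kernelK (contDiff_cosProfile h1).continuous (hasCompactSupport_cosProfile hs) hn]
    exact setIntegral_eq_zero_of_forall_eq_zero fun R hR => by rw [hK R hR, mul_zero]
  have hlimΛ : Tendsto (fun m => ⟪V m 0, toL2 (nKtest n)⟫_ℝ) atTop (𝓝 ⟪U 0, toL2 (nKtest n)⟫_ℝ) := (hΛ.tendsto U).comp hlim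
  have hzero : ⟪U 0, toL2 (nKtest n)⟫_ℝ = 0 := tendsto_nhds_unique hlimΛ (by simp_rw [hgraph]; exact tendsto_const_nhds)
  rw [inner_toL2_eq_integral _ hφm] at hzero
  rw [← hzero]
  exact setIntegral_congr_fun measurableSet_strip fun p hp => by rw [nKtest_eq hp]

/-! ### The solution family: shifts, orthogonality to `K`, finiteness of the `𝓗⁴` norms -/

namespace TangentialFamily

variable {α : ℝ} {f Ψ : ℝ → ℝ → ℝ} (h : TangentialFamily α f Ψ)
include h

/-- **Shift**: `(D_R^jf, D_R^jΨ)` is again a tangential family. [folklore] -/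
theorem shift (j : ℕ) : TangentialFamily α (Dz^[j] f) (Dz^[j] Ψ) := by
  refine ⟨h.smooth_iterate j, fun n => contDiff_iterate_Dz_of_contDiff (n := n) (m := j) (h.datum_smooth (n + j)),
    hasCompactSupport_iterate_Dz h.datum_supp j, fun k p hp => ?_, fun k => ?_, fun k => ?_, fun k => ?_⟩
  · rw [← Function.iterate_add_apply, ← Function.iterate_add_apply]; exact h.eqn (k + j) p hp
  · rw [← Function.iterate_add_apply]; exact h.sq_int (k + j)
  · rw [← Function.iterate_add_apply]; exact h.dθ_sq_int (k + j)
  · rw [← Function.iterate_add_apply]; exact h.hardy_int (k + j)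

/-- **`K`-moments of a tangential family vanish** when the family is orthogonal to all `n(R)K(θ)`:
`kMoment Ψ R = 0` for `R > 0`. [folklore] -/
theorem kMoment_eq_zero (HΨ : ∀ n : ℝ → ℝ, Continuous n → HasCompactSupport n → ∫ p in strip, Ψ p.1 p.2 * (n p.1 * kernelK p.2) = 0)
    {R : ℝ} (hR : 0 < R) : kMoment Ψ R = 0 := by
  -- a radial bump `η = 1` near `R`, supported in `(R/4, 7R/4)`
  set ρ : ContDiffBump R := ⟨R / 2, 3 * R / 4, by positivity, by linarith⟩
  have hρc : ContDiff ℝ ∞ ρ := ρ.contDiff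
  have hρs : HasCompactSupport ρ := ρ.hasCompactSupport
  have hρpos : tsupport (ρ : ℝ → ℝ) ⊆ Ioi 0 := by
    intro x hx
    rw [ρ.tsupport_eq, Metric.mem_closedBall, Real.dist_eq] at hx
    have : |x - R| ≤ 3 * R / 4 := hx
    rw [abs_le] at this
    show 0 < x; linarith
  obtain ⟨χt, hχt, hχts, -, -, hstrip⟩ := h.exists_smooth_profile hρc hρs hρpos
  set g : ℝ → ℝ → ℝ := fun R θ => Real.cos θ * χt R θ with hg
  have hχt1 : ContDiff ℝ 1 (uncurry χt) := by have := contDiff_infty.1 hχt 1; exact this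
  have hgc : Continuous (uncurry g) := (contDiff_cosProfile hχt1).continuous
  have hgs : HasCompactSupport (uncurry g) := hasCompactSupport_cosProfile hχts
  have HG : ∀ n : ℝ → ℝ, Continuous n → HasCompactSupport n → ∫ p in strip, g p.1 p.2 * (n p.1 * kernelK p.2) = 0 := by
    intro n hn hns
    have e : ∫ p in strip, g p.1 p.2 * (n p.1 * kernelK p.2) = ∫ p in strip, Ψ p.1 p.2 * ((fun x => ρ x * n x) p.1 * kernelK p.2) :=
      setIntegral_congr_fun measurableSet_strip fun p hp => by
        show Real.cos p.2 * χt p.1 p.2 * (n p.1 * kernelK p.2) = Ψ p.1 p.2 * (ρ p.1 * n p.1 * kernelK p.2)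
        rw [hstrip p hp]; ring
    rw [e]
    exact HΨ _ (ρ.continuous.mul hn) hns.mul_left
  have hm := kMoment_eq_zero_of_orth hgc hgs HG hR
  -- `kMoment g R = ρ(R)·kMoment Ψ R = kMoment Ψ R`
  have hρ1 : ρ R = 1 := ρ.one_of_mem_closedBall (Metric.mem_closedBall_self (by positivity))
  have e2 : kMoment g R = kMoment Ψ R := by
    rw [kMoment_def, kMoment_def]
    refine setIntegral_congr_fun measurableSet_Ioo fun θ hθ => ?_
    show Real.cos θ * χt R θ * kernelK θ = Ψ R θ * kernelK θ
    rw [hstrip (R, θ) ⟨hR, hθ⟩, hρ1, one_mul]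
  rw [← e2]; exact hm

end TangentialFamily

/-! ### Finiteness of the terms of the `𝓗ᵏ` functional -/

/-- Finite terms give a finite functional. [folklore] -/
theorem eHkNormSq_lt_top_of_terms {α : ℝ} {k : ℕ} {g : ℝ → ℝ → ℝ} (hr : ∀ j, j ≤ k → eL2Sq (hkRadialTerm j g) < ⊤)
    (hm : ∀ i j, 1 ≤ i → i + j ≤ k → eL2Sq (hkMixedTerm α i j g) < ⊤) : eHkNormSq α k g < ⊤ := by
  unfold eHkNormSq
  refine ENNReal.add_lt_top.2 ⟨ENNReal.sum_lt_top.2 fun j hj => hr j (Nat.lt_succ_iff.1 (mem_range.1 hj)), ENNReal.sum_lt_top.2 fun i _ => ENNReal.sum_lt_top.2 fun j _ => ?_⟩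
  by_cases hij : 1 ≤ i ∧ i + j ≤ k
  · simp only [hij, and_self, if_true]; exact hm i j hij.1 hij.2
  · simp only [hij, if_false]; exact ENNReal.zero_lt_top

/-- A real-integrable nonnegative dominant makes `eL2Sq` finite. [folklore] -/
theorem eL2Sq_lt_top_of_sq_le {g : ℝ → ℝ → ℝ} {H : ℝ × ℝ → ℝ} (hH : IntegrableOn H strip) (hle : ∀ p ∈ strip, g p.1 p.2 ^ 2 ≤ H p) :
    eL2Sq g < ⊤ := by
  rw [eL2Sq_eq_lintegral_ofReal]
  calc ∫⁻ p in strip, ENNReal.ofReal (g p.1 p.2 ^ 2) ≤ ∫⁻ p in strip, ENNReal.ofReal (H p) :=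
        setLIntegral_mono' measurableSet_strip fun p hp => ENNReal.ofReal_le_ofReal (hle p hp)
    _ < ⊤ := by
        have := hH.hasFiniteIntegral
        rw [HasFiniteIntegral] at this
        refine lt_of_le_of_lt (lintegral_mono fun p => ?_) this
        rw [Real.enorm_eq_ofReal_abs]
        exact ENNReal.ofReal_le_ofReal (le_abs_self _)

/-- `s^{−c} ≤ s^{−2}` on `(0,1]` for `c ≤ 2`, applied to `s = sin 2θ` on the strip. [folklore] -/
theorem sin_rpow_neg_le_inv_sq {c : ℝ} (hc : c ≤ 2) {p : ℝ × ℝ} (hp : p ∈ strip) :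
    Real.sin (2 * p.2) ^ (-c) ≤ 1 / Real.sin (2 * p.2) ^ 2 := by
  have hs : 0 < Real.sin (2 * p.2) := Real.sin_pos_of_pos_of_lt_pi (by linarith [hp.2.1]) (by linarith [hp.2.2])
  have hs1 : Real.sin (2 * p.2) ≤ 1 := Real.sin_le_one _
  rw [one_div, ← Real.rpow_natCast, ← Real.rpow_neg hs.le]
  exact Real.rpow_le_rpow_of_exponent_ge hs hs1 (by push_cast; linarith)

/-- `s^{2n−c} ≤ s^{2n−2}` on the strip for `c ≤ 2`... in the form used: `s^{a} ≤ s^{m}` for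
`(m:ℝ) ≤ a`, `s = sin 2θ ∈ (0,1]`. [folklore] -/
theorem sin_rpow_le_pow {a : ℝ} {m : ℕ} (hma : (m : ℝ) ≤ a) {p : ℝ × ℝ} (hp : p ∈ strip) :
    Real.sin (2 * p.2) ^ a ≤ Real.sin (2 * p.2) ^ m := by
  have hs : 0 < Real.sin (2 * p.2) := Real.sin_pos_of_pos_of_lt_pi (by linarith [hp.2.1]) (by linarith [hp.2.2])
  have hs1 : Real.sin (2 * p.2) ≤ 1 := Real.sin_le_one _
  rw [← Real.rpow_natCast]
  exact Real.rpow_le_rpow_of_exponent_ge hs hs1 hma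

/-- **The data of the transfer**: `0 < α ≤ 1/4`, a smooth datum `f` supported inside `R > 0` and
orthogonal to `K`, the weak solutions `U⁽ʲ⁾` with data `D_R^jf`, and the smooth representative `Ψ̃`
of `U⁽⁰⁾₀`. [folklore] -/
structure SolData (α : ℝ) (f : ℝ → ℝ → ℝ) (U : ℕ → E4) (Ψ : ℝ × ℝ → ℝ) : Prop where
  pos : 0 < α
  le4 : α ≤ 1 / 4
  fn : ∀ n : ℕ, ContDiff ℝ n (uncurry f)
  fs : HasCompactSupport (uncurry f)
  fpos : ∀ p ∈ tsupport (uncurry f), 0 < p.1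
  forth : ∀ n : ℝ → ℝ, Continuous n → HasCompactSupport n → ∫ p in strip, f p.1 p.2 * (n p.1 * kernelK p.2) = 0
  sol : ∀ j, IsWeakSol α (toL2 fun p : ℝ × ℝ => (Dz^[j] f) p.1 p.2) (U j)
  smooth : ContDiffOn ℝ ∞ Ψ strip
  ae : ∀ᵐ y ∂(volume : Measure (ℝ × ℝ)), y ∈ strip → (U 0 0 : ℝ × ℝ → ℝ) y = Ψ y

namespace SolData

variable {α : ℝ} {f : ℝ → ℝ → ℝ} {U : ℕ → E4} {Ψ : ℝ × ℝ → ℝ} (hS : SolData α f U Ψ)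
include hS

/-- `α ≤ 1`. [folklore] -/
theorem le1 : α ≤ 1 := hS.le4.trans (by norm_num)

/-- The weighted memberships `V_j, ∂_θV_j, tan θ·V_j ∈ MemW`. [folklore] -/
theorem memW_all (j : ℕ) : MemW (Dz^[j] fun R θ => Ψ (R, θ)) ∧ MemW (dθ (Dz^[j] fun R θ => Ψ (R, θ))) ∧
    MemW (fun R θ => Real.tan θ * (Dz^[j] fun R θ => Ψ (R, θ)) R θ) := by
  have := tangential_weighted_sq_integrable hS.pos hS.le1 hS.fn hS.fs hS.sol hS.smooth hS.ae hS.le4 hS.fpos j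
  exact ⟨this.1, this.2.1, this.2.2⟩

/-- The weighted Hardy membership `wV_j/sin 2θ ∈ L²(strip)`. [folklore] -/
theorem hardyW (j : ℕ) : IntegrableOn (fun p : ℝ × ℝ => radialWeight p.1 ^ 2 * ((Dz^[j] fun R θ => Ψ (R, θ)) p.1 p.2 ^ 2 / Real.sin (2 * p.2) ^ 2)) strip := by
  have hF := integrableOn_weighted_datum hS.fn hS.fs hS.fpos j
  have hfin := (weightedEnergy_le hS.pos hS.le4 (hS.sol j).mem (hS.sol j).eq hF 2).1
  have hH := integrableOn_weighted_sq_div_sin_sq (hS.sol j).mem hfin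
  refine hH.congr ?_
  filter_upwards [(ae_restrict_iff' measurableSet_strip).2 (weakSol_zero_ae_eq hS.pos hS.le1 hS.fn hS.fs hS.sol hS.smooth hS.ae j)] with y hy
  rw [hy]

/-- **The `𝓗⁴` functional of every solution iterate is finite.** [folklore] -/
theorem eHkNormSq_iterate_lt_top (m : ℕ) : eHkNormSq α 4 (Dz^[m] fun R θ => Ψ (R, θ)) < ⊤ := by
  have h := (tangentialFamily hS.pos hS.le1 hS.fn hS.fs hS.forth hS.sol hS.smooth hS.ae)
  have hfpos := hS.fpos
  have hα4 := hS.le4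
  set V : ℕ → ℝ → ℝ → ℝ := fun j => Dz^[j] fun R θ => Ψ (R, θ) with hV
  have hVadd : ∀ j, Dz^[j] (V m) = V (j + m) := fun j => by simp only [hV]; rw [← Function.iterate_add_apply]
  have hγ2 : gammaExp α ≤ 2 := by unfold gammaExp; linarith
  refine eHkNormSq_lt_top_of_terms (fun j hj => ?_) (fun i j hi hij => ?_)
  · -- radial terms: `w²V²s^{−η} ≤ w²V²/s²`
    refine eL2Sq_lt_top_of_sq_le (hS.hardyW (j + m)) fun p hp => ?_
    rw [sq_hkRadialTerm j _ hp, hVadd j]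
    have h1 := sin_rpow_neg_le_inv_sq (c := eta) (by unfold eta; norm_num) hp
    have hw : 0 ≤ radialWeight p.1 ^ 2 * V (j + m) p.1 p.2 ^ 2 := by positivity
    calc radialWeight p.1 ^ 2 * V (j + m) p.1 p.2 ^ 2 * Real.sin (2 * p.2) ^ (-eta)
        ≤ radialWeight p.1 ^ 2 * V (j + m) p.1 p.2 ^ 2 * (1 / Real.sin (2 * p.2) ^ 2) := mul_le_mul_of_nonneg_left h1 hw
      _ = radialWeight p.1 ^ 2 * (V (j + m) p.1 p.2 ^ 2 / Real.sin (2 * p.2) ^ 2) := by ring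
  · -- mixed terms: up-estimates and the global weighted bounds
    have hi4 : i ≤ 4 := by omega
    have hW := fun j => hS.memW_all j
    have hVall : ∀ j, MemW (V j) := fun j => (hW j).1
    have hdVall : ∀ j, MemW (dθ (V j)) := fun j => (hW j).2.1
    have htVall : ∀ j, MemW (fun R θ => Real.tan θ * V j R θ) := fun j => (hW j).2.2
    set n := j + m with hn
    have I1 : IntegrableOn (fun p : ℝ × ℝ => radialWeight p.1 ^ 2 * dθ (V n) p.1 p.2 ^ 2) strip := hdVall n
    have I2 : IntegrableOn (fun p : ℝ × ℝ => radialWeight p.1 ^ 2 * (Real.sin (2 * p.2) * dθ (dθ (V n)) p.1 p.2) ^ 2) strip :=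
      h.memW_sin_dθ2 hVall hdVall htVall hfpos n
    have I3 : IntegrableOn (fun p : ℝ × ℝ => radialWeight p.1 ^ 2 * (Real.sin (2 * p.2) ^ 2 * (dθ^[3] (V n)) p.1 p.2) ^ 2) strip :=
      h.memW_sin2_dθ3 hVall hdVall htVall hfpos n
    have I4 : IntegrableOn (fun p : ℝ × ℝ => radialWeight p.1 ^ 2 * (Real.sin (2 * p.2) ^ 3 * (dθ^[4] (V n)) p.1 p.2) ^ 2) strip :=
      h.memW_sin3_dθ4 hVall hdVall htVall hfpos n
    have hH : IntegrableOn (fun p : ℝ × ℝ => 6400 * (radialWeight p.1 ^ 2 * dθ (V n) p.1 p.2 ^ 2 +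
        radialWeight p.1 ^ 2 * (Real.sin (2 * p.2) * dθ (dθ (V n)) p.1 p.2) ^ 2 +
        radialWeight p.1 ^ 2 * (Real.sin (2 * p.2) ^ 2 * (dθ^[3] (V n)) p.1 p.2) ^ 2 +
        radialWeight p.1 ^ 2 * (Real.sin (2 * p.2) ^ 3 * (dθ^[4] (V n)) p.1 p.2) ^ 2)) strip :=
      (((I1.add I2).add I3).add I4).const_mul 6400
    refine eL2Sq_lt_top_of_sq_le hH fun p hp => ?_
    rw [sq_hkMixedTerm α i j _ hp, hVadd j]
    have hup := up_le_strip (h.smooth_iterate n) (gammaExp α) hi hi4 hp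
    have hs0 : 0 ≤ Real.sin (2 * p.2) := (Real.sin_pos_of_pos_of_lt_pi (by linarith [hp.2.1]) (by linarith [hp.2.2])).le
    have hw0 : 0 ≤ radialWeight p.1 ^ 2 := sq_nonneg _
    have e1 : Real.sin (2 * p.2) ^ (2 - gammaExp α) ≤ Real.sin (2 * p.2) ^ (0:ℕ) := sin_rpow_le_pow (by push_cast; linarith) hp
    have e2 : Real.sin (2 * p.2) ^ (4 - gammaExp α) ≤ Real.sin (2 * p.2) ^ (2:ℕ) := sin_rpow_le_pow (by push_cast; linarith) hp
    have e3 : Real.sin (2 * p.2) ^ (6 - gammaExp α) ≤ Real.sin (2 * p.2) ^ (4:ℕ) := sin_rpow_le_pow (by push_cast; linarith) hp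
    have e4 : Real.sin (2 * p.2) ^ (8 - gammaExp α) ≤ Real.sin (2 * p.2) ^ (6:ℕ) := sin_rpow_le_pow (by push_cast; linarith) hp
    have t1 : radialWeight p.1 ^ 2 * dθ (V n) p.1 p.2 ^ 2 * Real.sin (2 * p.2) ^ (2 - gammaExp α) ≤ radialWeight p.1 ^ 2 * dθ (V n) p.1 p.2 ^ 2 := by
      have := mul_le_mul_of_nonneg_left e1 (mul_nonneg hw0 (sq_nonneg (dθ (V n) p.1 p.2)))
      simpa using this
    have t2 : radialWeight p.1 ^ 2 * dθ (dθ (V n)) p.1 p.2 ^ 2 * Real.sin (2 * p.2) ^ (4 - gammaExp α) ≤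
        radialWeight p.1 ^ 2 * (Real.sin (2 * p.2) * dθ (dθ (V n)) p.1 p.2) ^ 2 := by
      have := mul_le_mul_of_nonneg_left e2 (mul_nonneg hw0 (sq_nonneg (dθ (dθ (V n)) p.1 p.2)))
      nlinarith [this]
    have t3 : radialWeight p.1 ^ 2 * (dθ^[3] (V n)) p.1 p.2 ^ 2 * Real.sin (2 * p.2) ^ (6 - gammaExp α) ≤
        radialWeight p.1 ^ 2 * (Real.sin (2 * p.2) ^ 2 * (dθ^[3] (V n)) p.1 p.2) ^ 2 := by
      have := mul_le_mul_of_nonneg_left e3 (mul_nonneg hw0 (sq_nonneg ((dθ^[3] (V n)) p.1 p.2)))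
      nlinarith [this]
    have t4 : radialWeight p.1 ^ 2 * (dθ^[4] (V n)) p.1 p.2 ^ 2 * Real.sin (2 * p.2) ^ (8 - gammaExp α) ≤
        radialWeight p.1 ^ 2 * (Real.sin (2 * p.2) ^ 3 * (dθ^[4] (V n)) p.1 p.2) ^ 2 := by
      have := mul_le_mul_of_nonneg_left e4 (mul_nonneg hw0 (sq_nonneg ((dθ^[4] (V n)) p.1 p.2)))
      nlinarith [this]
    linarith [hup, t1, t2, t3, t4]

/-! ### Orthogonality of the solution iterates to `K` -/

/-- `∫∫ (D_R^jΨ̃)·n(R)K(θ) = 0` for all continuous compactly supported `n`. [folklore] -/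
theorem integral_iterate_nK (j : ℕ) {n : ℝ → ℝ} (hn : Continuous n) (hns : HasCompactSupport n) :
    ∫ p in strip, (Dz^[j] fun R θ => Ψ (R, θ)) p.1 p.2 * (n p.1 * kernelK p.2) = 0 := by
  have h0 := integral_weakSpace_nK (hS.sol j).mem hn hns
  rw [← h0]
  refine integral_congr_ae ?_
  filter_upwards [(ae_restrict_iff' measurableSet_strip).2 (weakSol_zero_ae_eq hS.pos hS.le1 hS.fn hS.fs hS.sol hS.smooth hS.ae j)] with y hy
  rw [hy]

/-- **`kMoment (D_R^jΨ̃) R = 0` for `R > 0`.** [cite: Elgindi2021, §7.1 proof of Proposition 7.1, Step 1 (p. 19 of arXiv:1904.04795)] -/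
theorem kMoment_iterate_eq_zero (j : ℕ) {R : ℝ} (hR : 0 < R) : kMoment (Dz^[j] fun R θ => Ψ (R, θ)) R = 0 :=
  ((tangentialFamily hS.pos hS.le1 hS.fn hS.fs hS.forth hS.sol hS.smooth hS.ae).shift j).kMoment_eq_zero (fun _ hn hns => hS.integral_iterate_nK j hn hns) hR

/-- `kMoment f R = 0` for `R > 0`. [folklore] -/
theorem kMoment_datum_eq_zero {R : ℝ} (hR : 0 < R) : kMoment f R = 0 :=
  kMoment_eq_zero_of_orth (hS.fn 0).continuous hS.fs hS.forth hR

/-! ### The cut-off profiles -/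

/-- **The cut-off profile at level `ν > 0`**: a `χ̃ ∈ C_c^∞` with `cos θ·χ̃ = η_νΨ̃` on the strip. [folklore] -/
theorem exists_prof {ν : ℝ} (hν : 0 < ν) : ∃ χt : ℝ → ℝ → ℝ, ContDiff ℝ ∞ (uncurry χt) ∧ HasCompactSupport (uncurry χt) ∧
    (∀ p ∈ tsupport (uncurry χt), 0 < p.1) ∧ (∀ R, χt R 0 = 0) ∧
    ∀ p ∈ strip, Real.cos p.2 * χt p.1 p.2 = etaCutPos ν p.1 * Ψ (p.1, p.2) :=
  (tangentialFamily hS.pos hS.le1 hS.fn hS.fs hS.forth hS.sol hS.smooth hS.ae).exists_smooth_profile (contDiff_etaCutPos hν) (hasCompactSupport_etaCutPos hν) (tsupport_etaCutPos hν)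

/-- The chosen profile at level `ν` (junk for `ν ≤ 0`). [folklore] -/
def prof (ν : ℝ) : ℝ → ℝ → ℝ :=
  if hν : 0 < ν then Classical.choose (hS.exists_prof hν) else 0

/-- Its specification. [folklore] -/
theorem prof_spec {ν : ℝ} (hν : 0 < ν) : ContDiff ℝ ∞ (uncurry (hS.prof ν)) ∧ HasCompactSupport (uncurry (hS.prof ν)) ∧
    (∀ p ∈ tsupport (uncurry (hS.prof ν)), 0 < p.1) ∧ (∀ R, hS.prof ν R 0 = 0) ∧
    ∀ p ∈ strip, Real.cos p.2 * hS.prof ν p.1 p.2 = etaCutPos ν p.1 * Ψ (p.1, p.2) := by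
  have e : hS.prof ν = Classical.choose (hS.exists_prof hν) := by unfold prof; rw [dif_pos hν]
  rw [e]
  exact Classical.choose_spec (hS.exists_prof hν)

/-- The cut-off solution `Ψ_ν = cos θ·χ̃_ν`. [folklore] -/
def PsiN (ν : ℝ) : ℝ → ℝ → ℝ := fun R θ => Real.cos θ * hS.prof ν R θ

/-- **`Ψ_ν = η_νΨ̃` on the strip.** [folklore] -/
theorem PsiN_eq_strip {ν : ℝ} (hν : 0 < ν) : ∀ p ∈ strip, hS.PsiN ν p.1 p.2 = radialMul (etaCut ν) (fun R θ => Ψ (R, θ)) p.1 p.2 := by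
  intro p hp
  show Real.cos p.2 * hS.prof ν p.1 p.2 = etaCut ν p.1 * Ψ (p.1, p.2)
  rw [(hS.prof_spec hν).2.2.2.2 p hp, etaCutPos_of_pos hp.1]

/-- `Ψ_ν` is globally smooth. [folklore] -/
theorem contDiff_PsiN {ν : ℝ} (hν : 0 < ν) (m : ℕ) : ContDiff ℝ m (uncurry (hS.PsiN ν)) := by
  have h1 : ContDiff ℝ m (uncurry (hS.prof ν)) := by
    have := contDiff_infty.1 (hS.prof_spec hν).1 m; exact this
  exact (Real.contDiff_cos.comp contDiff_snd).mul h1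

end SolData

/-! ### The commutator coefficients of the logarithmic cut-offs -/

/-- A uniform bound for the first seven derivatives of the logPlateau. [folklore] -/
theorem exists_logPlateau_bound : ∃ P : ℝ, 0 ≤ P ∧ ∀ l, l ≤ 6 → ∀ s, |iteratedDeriv l logPlateau s| ≤ P := by
  have hb : ∀ l, ∃ B, 0 ≤ B ∧ ∀ s, |iteratedDeriv l logPlateau s| ≤ B := fun l =>
    exists_bound_of_hasCompactSupport (contDiff_logPlateau.continuous_iteratedDeriv l (by exact_mod_cast le_top)) (Literature.Analysis.Distribution.hasCompactSupport_iteratedDeriv hasCompactSupport_logPlateau l)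
  choose B hB0 hB using hb
  refine ⟨∑ l ∈ range 7, B l, sum_nonneg fun l _ => hB0 l, fun l hl s => (hB l s).trans ?_⟩
  exact single_le_sum (f := B) (fun i _ => hB0 i) (mem_range.2 (by omega))

/-- `p′ ∈ C^∞`. [folklore] -/
theorem contDiff_deriv_logPlateau : ContDiff ℝ ∞ (deriv logPlateau) := by
  have := contDiff_logPlateau.iterate_deriv 1; simpa using this

/-- `p″ ∈ C^∞`. [folklore] -/
theorem contDiff_deriv2_logPlateau : ContDiff ℝ ∞ (deriv (deriv logPlateau)) := by
  have := contDiff_logPlateau.iterate_deriv 2; simpa using this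

/-- `deriv (logCut ν G) = R⁻¹ν⁻¹·logCut ν G′` on `(0,∞)`. [folklore] -/
theorem deriv_logCut {ν : ℝ} (hν : ν ≠ 0) {G : ℝ → ℝ} (hG : Differentiable ℝ G) {R : ℝ} (hR : 0 < R) :
    deriv (logCut ν G) R = R⁻¹ * (ν⁻¹ * logCut ν (deriv G) R) := by
  have h := Dz₁_logCut hν hG hR
  unfold Dz₁ at h
  field_simp at h ⊢
  linarith [h]

/-- **The commutator coefficients**: on `(0,∞)`, `Rη′ = ν⁻¹p′(log R/ν)` and
`R²η″ = −ν⁻¹p′(log R/ν) + ν⁻²p″(log R/ν)` (`η = p(log R/ν)`, `p` the logPlateau). [folklore] -/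
theorem etaCut_derivs {ν : ℝ} (hν : ν ≠ 0) {R : ℝ} (hR : 0 < R) :
    R * deriv (etaCut ν) R = ν⁻¹ * logCut ν (deriv logPlateau) R ∧
    R ^ 2 * deriv (deriv (etaCut ν)) R = -(ν⁻¹ * logCut ν (deriv logPlateau) R) + ν⁻¹ ^ 2 * logCut ν (deriv (deriv logPlateau)) R := by
  have hp1 : Differentiable ℝ logPlateau := contDiff_logPlateau.differentiable (by simp)
  have hp2 : Differentiable ℝ (deriv logPlateau) := contDiff_deriv_logPlateau.differentiable (by simp)
  have e1 : ∀ r, 0 < r → deriv (etaCut ν) r = r⁻¹ * (ν⁻¹ * logCut ν (deriv logPlateau) r) := fun r hr => deriv_logCut hν hp1 hr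
  refine ⟨by rw [e1 R hR]; field_simp, ?_⟩
  -- differentiate `e1` (an identity on the open set `(0,∞)`)
  have hev : deriv (etaCut ν) =ᶠ[𝓝 R] fun r => r⁻¹ * (ν⁻¹ * logCut ν (deriv logPlateau) r) := by
    filter_upwards [Ioi_mem_nhds hR] with r hr; exact e1 r hr
  rw [hev.deriv_eq]
  have hlc : HasDerivAt (logCut ν (deriv logPlateau)) (R⁻¹ * (ν⁻¹ * logCut ν (deriv (deriv logPlateau)) R)) R := by
    have hd : DifferentiableAt ℝ (logCut ν (deriv logPlateau)) R := by
      unfold logCut; exact (hp2 _).comp R ((Real.differentiableAt_log hR.ne').div_const ν)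
    rw [← deriv_logCut hν hp2 hR]; exact hd.hasDerivAt
  have hinv : HasDerivAt (fun r : ℝ => r⁻¹) (-(R ^ 2)⁻¹) R := hasDerivAt_inv hR.ne'
  have hall := hinv.mul (hlc.const_mul ν⁻¹)
  have hall' : HasDerivAt (fun r => r⁻¹ * (ν⁻¹ * logCut ν (deriv logPlateau) r)) _ R := hall
  rw [hall'.deriv]
  field_simp

/-- The profile of the coefficient of `D_RΨ̃`: `G_A = −2α²ν⁻¹p′`. [folklore] -/
def profA (α ν : ℝ) (s : ℝ) : ℝ := -2 * α ^ 2 * ν⁻¹ * deriv logPlateau s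
/-- The profile of the coefficient of `Ψ̃`: `G_B = −5αν⁻¹p′ − α²ν⁻²p″`. [folklore] -/
def profB (α ν : ℝ) (s : ℝ) : ℝ := -5 * α * ν⁻¹ * deriv logPlateau s - α ^ 2 * ν⁻¹ ^ 2 * deriv (deriv logPlateau) s

/-- Smoothness of the profiles. [folklore] -/
theorem contDiff_profA (α ν : ℝ) : ContDiff ℝ ∞ (profA α ν) := by
  unfold profA; exact contDiff_const.mul contDiff_deriv_logPlateau
/-- Smoothness of the profiles. [folklore] -/
theorem contDiff_profB (α ν : ℝ) : ContDiff ℝ ∞ (profB α ν) := by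
  unfold profB; exact (contDiff_const.mul contDiff_deriv_logPlateau).sub (contDiff_const.mul contDiff_deriv2_logPlateau)

/-- Iterated derivatives of the profiles. [folklore] -/
theorem iteratedDeriv_profA (α ν : ℝ) (l : ℕ) (s : ℝ) : iteratedDeriv l (profA α ν) s = -2 * α ^ 2 * ν⁻¹ * iteratedDeriv (l + 1) logPlateau s := by
  unfold profA
  rw [iteratedDeriv_const_mul_field, iteratedDeriv_succ']

/-- Iterated derivatives of the profiles. [folklore] -/
theorem iteratedDeriv_profB (α ν : ℝ) (l : ℕ) (s : ℝ) : iteratedDeriv l (profB α ν) s =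
    -5 * α * ν⁻¹ * iteratedDeriv (l + 1) logPlateau s - α ^ 2 * ν⁻¹ ^ 2 * iteratedDeriv (l + 2) logPlateau s := by
  unfold profB
  have h1 : ContDiffAt ℝ l (fun s => -5 * α * ν⁻¹ * deriv logPlateau s) s :=
    ((contDiff_const.mul contDiff_deriv_logPlateau).of_le (by exact_mod_cast le_top)).contDiffAt
  have h2 : ContDiffAt ℝ l (fun s => (-(α ^ 2 * ν⁻¹ ^ 2)) * deriv (deriv logPlateau) s) s :=
    ((contDiff_const.mul contDiff_deriv2_logPlateau).of_le (by exact_mod_cast le_top)).contDiffAt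
  rw [show (fun s => -5 * α * ν⁻¹ * deriv logPlateau s - α ^ 2 * ν⁻¹ ^ 2 * deriv (deriv logPlateau) s) =
    (fun s => -5 * α * ν⁻¹ * deriv logPlateau s) + fun s => (-(α ^ 2 * ν⁻¹ ^ 2)) * deriv (deriv logPlateau) s by funext s; simp only [Pi.add_apply]; ring]
  rw [iteratedDeriv_add h1 h2, iteratedDeriv_const_mul_field, iteratedDeriv_const_mul_field]
  have e1 : iteratedDeriv l (deriv logPlateau) s = iteratedDeriv (l + 1) logPlateau s := by rw [iteratedDeriv_succ']
  have e2 : iteratedDeriv l (deriv (deriv logPlateau)) s = iteratedDeriv (l + 2) logPlateau s := by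
    rw [iteratedDeriv_succ', iteratedDeriv_succ']
  rw [e1, e2]
  ring

/-- **Bounds**: for `ν ≥ 1`, `0 < α ≤ 1` and `l ≤ 4`, `|Dz₁^l(logCut ν G_A)|, |Dz₁^l(logCut ν G_B)| ≤ 6P/ν` on `(0,∞)`. [folklore] -/
theorem coef_bounds {α : ℝ} (hα : 0 < α) (hα1 : α ≤ 1) {P : ℝ} (hP : 0 ≤ P ∧ ∀ l, l ≤ 6 → ∀ s, |iteratedDeriv l logPlateau s| ≤ P)
    {ν : ℝ} (hν : 1 ≤ ν) (l : ℕ) (hl : l ≤ 4) {R : ℝ} (hR : 0 < R) :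
    |(Dz₁^[l] (logCut ν (profA α ν))) R| ≤ 6 * P / ν ∧ |(Dz₁^[l] (logCut ν (profB α ν))) R| ≤ 6 * P / ν := by
  have hν0 : ν ≠ 0 := by positivity
  have hνinv : ν⁻¹ ≤ 1 := inv_le_one_of_one_le₀ hν
  have hνi0 : 0 ≤ ν⁻¹ := by positivity
  have hpow : (ν⁻¹) ^ l ≤ 1 := pow_le_one₀ hνi0 hνinv
  have hα2 : α ^ 2 ≤ α := by nlinarith
  constructor
  · rw [iterate_Dz₁_logCut hν0 (contDiff_profA α ν) l hR, abs_mul]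
    unfold logCut
    rw [iteratedDeriv_profA]
    have hb := hP.2 (l + 1) (by omega) (Real.log R / ν)
    rw [abs_of_nonneg (pow_nonneg hνi0 l)]
    have hx : 0 ≤ P * ν⁻¹ := mul_nonneg hP.1 hνi0
    calc (ν⁻¹) ^ l * |-2 * α ^ 2 * ν⁻¹ * iteratedDeriv (l + 1) logPlateau (Real.log R / ν)|
        ≤ 1 * (2 * α ^ 2 * ν⁻¹ * P) := by
          refine mul_le_mul hpow ?_ (abs_nonneg _) zero_le_one
          rw [abs_mul, show |-2 * α ^ 2 * ν⁻¹| = 2 * α ^ 2 * ν⁻¹ by rw [abs_of_nonpos (by nlinarith)]; ring]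
          exact mul_le_mul_of_nonneg_left hb (by positivity)
      _ = (2 * α ^ 2) * (P * ν⁻¹) := by ring
      _ ≤ 6 * (P * ν⁻¹) := mul_le_mul_of_nonneg_right (by nlinarith) hx
      _ = 6 * P / ν := by rw [div_eq_mul_inv]; ring
  · rw [iterate_Dz₁_logCut hν0 (contDiff_profB α ν) l hR, abs_mul]
    unfold logCut
    rw [iteratedDeriv_profB]
    have hb1 := hP.2 (l + 1) (by omega) (Real.log R / ν)
    have hb2 := hP.2 (l + 2) (by omega) (Real.log R / ν)
    rw [abs_of_nonneg (pow_nonneg hνi0 l)]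
    have htri : |-5 * α * ν⁻¹ * iteratedDeriv (l + 1) logPlateau (Real.log R / ν) - α ^ 2 * ν⁻¹ ^ 2 * iteratedDeriv (l + 2) logPlateau (Real.log R / ν)| ≤
        5 * α * ν⁻¹ * P + α ^ 2 * ν⁻¹ ^ 2 * P := by
      refine (abs_sub _ _).trans (add_le_add ?_ ?_)
      · rw [abs_mul, show |-5 * α * ν⁻¹| = 5 * α * ν⁻¹ by rw [abs_of_nonpos (by nlinarith)]; ring]
        exact mul_le_mul_of_nonneg_left hb1 (by positivity)
      · rw [abs_mul, abs_of_nonneg (by positivity)]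
        exact mul_le_mul_of_nonneg_left hb2 (by positivity)
    have hx : 0 ≤ P * ν⁻¹ := mul_nonneg hP.1 hνi0
    have hν2 : ν⁻¹ ^ 2 ≤ ν⁻¹ := by nlinarith
    calc (ν⁻¹) ^ l * |-5 * α * ν⁻¹ * iteratedDeriv (l + 1) logPlateau (Real.log R / ν) - α ^ 2 * ν⁻¹ ^ 2 * iteratedDeriv (l + 2) logPlateau (Real.log R / ν)|
        ≤ 1 * (5 * α * ν⁻¹ * P + α ^ 2 * ν⁻¹ ^ 2 * P) := mul_le_mul hpow htri (abs_nonneg _) zero_le_one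
      _ = (5 * α) * (P * ν⁻¹) + α ^ 2 * (P * ν⁻¹ ^ 2) := by ring
      _ ≤ 5 * (P * ν⁻¹) + 1 * (P * ν⁻¹) := by
          refine add_le_add (mul_le_mul_of_nonneg_right (by nlinarith) hx) ?_
          exact mul_le_mul (by nlinarith) (mul_le_mul_of_nonneg_left hν2 hP.1) (mul_nonneg hP.1 (sq_nonneg _)) zero_le_one
      _ = 6 * P / ν := by rw [div_eq_mul_inv]; ring

namespace SolData

variable {α : ℝ} {f : ℝ → ℝ → ℝ} {U : ℕ → E4} {Ψ : ℝ × ℝ → ℝ} (hS : SolData α f U Ψ)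
include hS

/-- **The datum of `Ψ_ν` on the strip**: `LΨ_ν = η_νf + G_A(log R/ν)·D_RΨ̃ + G_B(log R/ν)·Ψ̃`. [cite: Elgindi2021, §7.3 Step 3 (p. 21 of arXiv:1904.04795)] -/
theorem ellipticOp_PsiN {ν : ℝ} (hν : 0 < ν) {p : ℝ × ℝ} (hp : p ∈ strip) :
    ellipticOp α (hS.PsiN ν) p.1 p.2 = etaCut ν p.1 * f p.1 p.2 +
      (logCut ν (profA α ν) p.1 * (Dz fun R θ => Ψ (R, θ)) p.1 p.2 + logCut ν (profB α ν) p.1 * Ψ (p.1, p.2)) := by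
  have h := (tangentialFamily hS.pos hS.le1 hS.fn hS.fs hS.forth hS.sol hS.smooth hS.ae)
  rw [eqOn_ellipticOp α isOpen_strip (hS.PsiN_eq_strip hν) hp, ellipticOp_radialMul α (contDiffOn_etaCut ν) h.smooth hp]
  have e0 := h.eqn 0 p hp
  simp only [Function.iterate_zero, id_eq] at e0
  rw [e0]
  obtain ⟨e1, e2⟩ := etaCut_derivs hν.ne' hp.1
  rw [show p.1 * deriv (etaCut ν) p.1 = ν⁻¹ * logCut ν (deriv logPlateau) p.1 from e1,
    show p.1 ^ 2 * deriv (deriv (etaCut ν)) p.1 = -(ν⁻¹ * logCut ν (deriv logPlateau) p.1) + ν⁻¹ ^ 2 * logCut ν (deriv (deriv logPlateau)) p.1 from e2]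
  show _ = etaCut ν p.1 * f p.1 p.2 + (profA α ν (Real.log p.1 / ν) * (p.1 * dz (fun R θ => Ψ (R, θ)) p.1 p.2) + profB α ν (Real.log p.1 / ν) * Ψ (p.1, p.2))
  unfold profA profB logCut
  ring

/-- Slices of the solution iterates times `K` are integrable. [folklore] -/
theorem integrableOn_slice_kernelK (j : ℕ) {R : ℝ} (hR : 0 < R) :
    IntegrableOn (fun θ => (Dz^[j] fun R θ => Ψ (R, θ)) R θ * kernelK θ) (Ioo 0 (π / 2)) := by
  have h := (tangentialFamily hS.pos hS.le1 hS.fn hS.fs hS.forth hS.sol hS.smooth hS.ae)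
  obtain ⟨-, hI, -, -⟩ := h.slice j hR
  have hc : ContinuousOn (fun θ => (Dz^[j] fun R θ => Ψ (R, θ)) R θ) (Ioo 0 (π / 2)) := h.continuousOn_theta_slice (h.smooth_iterate j) hR
  have cK : Continuous kernelK := by unfold kernelK; fun_prop
  have hK3 : ∀ θ, |kernelK θ| ≤ 3 := fun θ => by
    unfold kernelK
    rw [abs_mul, abs_mul, abs_of_pos (by norm_num : (0:ℝ) < 3)]
    have h1 := Real.abs_sin_le_one θ
    have h2 : |Real.cos θ ^ 2| ≤ 1 := by rw [abs_of_nonneg (sq_nonneg _)]; nlinarith [Real.cos_sq_le_one θ]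
    nlinarith [abs_nonneg (Real.sin θ), abs_nonneg (Real.cos θ ^ 2)]
  -- `|VK| ≤ (V²/sin² + 9)/2`
  have hdom : IntegrableOn (fun θ => ((Dz^[j] fun R θ => Ψ (R, θ)) R θ ^ 2 / Real.sin (2 * θ) ^ 2 + 9) / 2) (Ioo 0 (π / 2)) :=
    (hI.add (integrableOn_const (by simp))).div_const 2
  refine Integrable.mono' hdom ((hc.mul cK.continuousOn).aestronglyMeasurable measurableSet_Ioo) ?_
  rw [ae_restrict_iff' measurableSet_Ioo]
  refine ae_of_all _ fun θ hθ => ?_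
  have hs : 0 < Real.sin (2 * θ) := Real.sin_pos_of_pos_of_lt_pi (by linarith [hθ.1]) (by linarith [hθ.2])
  have hs1 : Real.sin (2 * θ) ^ 2 ≤ 1 := by nlinarith [Real.sin_sq_le_one (2 * θ), sq_nonneg (Real.sin (2 * θ))]
  set v := (Dz^[j] fun R θ => Ψ (R, θ)) R θ
  rw [Real.norm_eq_abs, abs_mul]
  have hv2 : v ^ 2 ≤ v ^ 2 / Real.sin (2 * θ) ^ 2 := by
    rw [le_div_iff₀ (pow_pos hs 2)]; nlinarith [sq_nonneg v]
  nlinarith [hK3 θ, abs_nonneg v, abs_nonneg (kernelK θ), sq_abs v, sq_nonneg (|v| - |kernelK θ|), sq_nonneg (|kernelK θ| - 3)]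

/-- **The data of the cut-off solutions are orthogonal to `K`.** [folklore] -/
theorem horth_PsiN {ν : ℝ} (hν : 0 < ν) {R : ℝ} (hR : 0 < R) : ∫ θ in Ioo 0 (π / 2), ellipticOp α (hS.PsiN ν) R θ * kernelK θ = 0 := by
  have e : ∀ θ ∈ Ioo (0:ℝ) (π / 2), ellipticOp α (hS.PsiN ν) R θ * kernelK θ =
      etaCut ν R * (f R θ * kernelK θ) + (logCut ν (profA α ν) R * ((Dz fun R θ => Ψ (R, θ)) R θ * kernelK θ) +
        logCut ν (profB α ν) R * ((Dz^[0] fun R θ => Ψ (R, θ)) R θ * kernelK θ)) := by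
    intro θ hθ
    rw [hS.ellipticOp_PsiN hν (p := (R, θ)) ⟨hR, hθ⟩]
    simp only [Function.iterate_zero, id_eq]; ring
  rw [setIntegral_congr_fun measurableSet_Ioo e]
  have iF : IntegrableOn (fun θ => f R θ * kernelK θ) (Ioo 0 (π / 2)) := by
    have cK : Continuous kernelK := by unfold kernelK; fun_prop
    exact (((hS.fn 0).continuous.comp (Continuous.prodMk_right R)).mul cK).integrableOn_Icc.mono_set Ioo_subset_Icc_self
  have i1 := hS.integrableOn_slice_kernelK 1 hR
  have i0 := hS.integrableOn_slice_kernelK 0 hR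
  simp only [Function.iterate_one] at i1
  have iA : Integrable (fun θ => etaCut ν R * (f R θ * kernelK θ)) (volume.restrict (Ioo 0 (π / 2))) := iF.const_mul _
  have iB : Integrable (fun θ => logCut ν (profA α ν) R * ((Dz fun R θ => Ψ (R, θ)) R θ * kernelK θ)) (volume.restrict (Ioo 0 (π / 2))) := i1.const_mul _
  have iC : Integrable (fun θ => logCut ν (profB α ν) R * ((Dz^[0] fun R θ => Ψ (R, θ)) R θ * kernelK θ)) (volume.restrict (Ioo 0 (π / 2))) := i0.const_mul _
  have iBC : Integrable (fun θ => logCut ν (profA α ν) R * ((Dz fun R θ => Ψ (R, θ)) R θ * kernelK θ) +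
      logCut ν (profB α ν) R * ((Dz^[0] fun R θ => Ψ (R, θ)) R θ * kernelK θ)) (volume.restrict (Ioo 0 (π / 2))) := iB.add iC
  rw [integral_add iA iBC, integral_add iB iC, MeasureTheory.integral_const_mul, MeasureTheory.integral_const_mul, MeasureTheory.integral_const_mul]
  have k0 := hS.kMoment_iterate_eq_zero 0 hR
  have k1 := hS.kMoment_iterate_eq_zero 1 hR
  have kf := hS.kMoment_datum_eq_zero hR
  rw [kMoment_def] at k0 k1 kf
  simp only [Function.iterate_one] at k1
  rw [kf, k1, k0]; ring

end SolData

/-! ### The a-priori estimate at level `ν` and the bound of its right-hand side -/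

/-- Elgindi's a-priori constant. [folklore] -/
def aprioriC : ℝ≥0∞ := ENNReal.ofReal (90 * 300000000000000000000000) * ((15 : ℝ≥0∞) * ENNReal.ofReal 689220)

/-- The constant is finite. [folklore] -/
theorem aprioriC_ne_top : aprioriC ≠ ⊤ := by
  unfold aprioriC
  exact ENNReal.mul_ne_top ENNReal.ofReal_ne_top (ENNReal.mul_ne_top (by norm_num) ENNReal.ofReal_ne_top)

/-- The left-hand side functional `A(g) = |∂_θθg|² + |αD_Rg|² + |α²D_R²g|²` (all in `𝓗⁴`). [folklore] -/
def lhsA (α : ℝ) (g : ℝ → ℝ → ℝ) : ℝ≥0∞ :=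
  eHkNormSq α 4 (dθ (dθ g)) + eHkNormSq α 4 (α • Dz g) + eHkNormSq α 4 ((α ^ 2) • (Dz^[2] g))

namespace SolData

variable {α : ℝ} {f : ℝ → ℝ → ℝ} {U : ℕ → E4} {Ψ : ℝ × ℝ → ℝ} (hS : SolData α f U Ψ)
include hS

/-- **The a-priori estimate for the cut-off solutions.** [cite: Elgindi2021, §7.3 proof of Proposition 7.7, Step 2 (p. 21 of arXiv:1904.04795)] -/
theorem apriori_PsiN {ν : ℝ} (hν : 0 < ν) : lhsA α (hS.PsiN ν) ≤ aprioriC * eHkNormSq α 4 (ellipticOp α (hS.PsiN ν)) := by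
  obtain ⟨hsm, hs, hpos, hχ0, -⟩ := hS.prof_spec hν
  have h10 : ContDiff ℝ 10 (uncurry (hS.prof ν)) := by have := contDiff_infty.1 hsm 10; exact this
  exact elliptic_apriori_eHkNormSq hS.pos hS.le4 h10 hs hpos hχ0 (Ψ := hS.PsiN ν) rfl fun R hR => hS.horth_PsiN hν hR

/-- Radial bounds of the support of the datum. [folklore] -/
theorem exists_datum_radial_bounds : ∃ a b : ℝ, 0 < a ∧ ∀ p ∈ tsupport (uncurry f), a ≤ p.1 ∧ p.1 ≤ b := by
  have hK := hS.fs.isCompact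
  by_cases hne : (tsupport (uncurry f)).Nonempty
  · obtain ⟨p₀, hp₀, hmin⟩ := hK.exists_isMinOn hne continuous_fst.continuousOn
    obtain ⟨p₁, _, hmax⟩ := hK.exists_isMaxOn hne continuous_fst.continuousOn
    exact ⟨p₀.1, p₁.1, hS.fpos p₀ hp₀, fun p hp => ⟨hmin hp, hmax hp⟩⟩
  · exact ⟨1, 1, one_pos, fun p hp => absurd ⟨p, hp⟩ hne⟩

/-- **For large `ν` the cut-off does not touch the datum**: `η_νf = f`. [folklore] -/
theorem exists_level_datum : ∃ ν₀ : ℝ, 1 ≤ ν₀ ∧ ∀ ν, ν₀ ≤ ν → ∀ p : ℝ × ℝ, 0 < p.1 → etaCut ν p.1 * f p.1 p.2 = f p.1 p.2 := by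
  obtain ⟨a, b, ha, hab⟩ := hS.exists_datum_radial_bounds
  refine ⟨max 1 (max |Real.log a| |Real.log b|), le_max_left _ _, fun ν hν p hp => ?_⟩
  by_cases hf0 : f p.1 p.2 = 0
  · rw [hf0, mul_zero]
  · have hmem : p ∈ tsupport (uncurry f) := subset_closure (show uncurry f p ≠ 0 from hf0)
    obtain ⟨h1, h2⟩ := hab p hmem
    have hνpos : 0 < ν := lt_of_lt_of_le one_pos ((le_max_left _ _).trans hν)
    have hlog : |Real.log p.1| ≤ ν := by
      have la : Real.log a ≤ Real.log p.1 := Real.log_le_log ha h1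
      have lb : Real.log p.1 ≤ Real.log b := Real.log_le_log hp h2
      have : |Real.log p.1| ≤ max |Real.log a| |Real.log b| := by
        rw [abs_le]; constructor
        · have := neg_abs_le (Real.log a); linarith [le_max_left |Real.log a| |Real.log b|]
        · have := le_abs_self (Real.log b); linarith [le_max_right |Real.log a| |Real.log b|]
      exact this.trans ((le_max_right _ _).trans hν)
    rw [etaCut_eq_one hνpos hlog, one_mul]

/-- **Bound of the right-hand side**: for `ν ≥ ν₀`,
`|LΨ_ν|²_{𝓗⁴} ≤ 2|f|²_{𝓗⁴} + ofReal(4·192000·(6P/ν)²)·(|D_RΨ̃|²_{𝓗⁴} + |Ψ̃|²_{𝓗⁴})`. [folklore] -/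
theorem rhs_bound {P : ℝ} (hP : 0 ≤ P ∧ ∀ l, l ≤ 6 → ∀ s, |iteratedDeriv l logPlateau s| ≤ P) {ν₀ : ℝ} (hν₀ : 1 ≤ ν₀)
    (hdat : ∀ ν, ν₀ ≤ ν → ∀ p : ℝ × ℝ, 0 < p.1 → etaCut ν p.1 * f p.1 p.2 = f p.1 p.2) {ν : ℝ} (hν : ν₀ ≤ ν) :
    eHkNormSq α 4 (ellipticOp α (hS.PsiN ν)) ≤ 2 * eHkNormSq α 4 f +
      ENNReal.ofReal (4 * (192000 * (6 * P / ν) ^ 2)) * (eHkNormSq α 4 (Dz fun R θ => Ψ (R, θ)) + eHkNormSq α 4 (fun R θ => Ψ (R, θ))) := by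
  have h := (tangentialFamily hS.pos hS.le1 hS.fn hS.fs hS.forth hS.sol hS.smooth hS.ae)
  have hν1 : 1 ≤ ν := hν₀.trans hν
  have hνpos : 0 < ν := by linarith
  set Ψc : ℝ → ℝ → ℝ := fun R θ => Ψ (R, θ) with hΨc
  set cA : ℝ → ℝ := logCut ν (profA α ν)
  set cB : ℝ → ℝ := logCut ν (profB α ν)
  have h4 : (4 : WithTop ℕ∞) ≤ ((⊤ : ℕ∞) : WithTop ℕ∞) := WithTop.coe_le_coe.2 le_top
  have hcA : ContDiffOn ℝ 4 cA (Ioi 0) := (contDiffOn_logCut ν (contDiff_profA α ν)).of_le h4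
  have hcB : ContDiffOn ℝ 4 cB (Ioi 0) := (contDiffOn_logCut ν (contDiff_profB α ν)).of_le h4
  have hΨ4 : ContDiffOn ℝ 4 (uncurry Ψc) strip := h.smooth.of_le h4
  have hDzΨ4 : ContDiffOn ℝ 4 (uncurry (Dz Ψc)) strip := by
    have := h.smooth_iterate 1; simp only [Function.iterate_one] at this; exact this.of_le h4
  have hf4 : ContDiffOn ℝ 4 (uncurry f) strip := (hS.fn 4).contDiffOn
  -- the datum of `Ψ_ν` on the strip
  have e1 : ∀ p ∈ strip, ellipticOp α (hS.PsiN ν) p.1 p.2 = (f + (radialMul cA (Dz Ψc) + radialMul cB Ψc)) p.1 p.2 := by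
    intro p hp
    rw [hS.ellipticOp_PsiN hνpos hp, hdat ν hν p hp.1]
    simp only [Pi.add_apply, radialMul_apply]
    rfl
  rw [eHkNormSq_congr_strip α 4 e1]
  have hF2 : ContDiffOn ℝ 4 (uncurry (radialMul cA (Dz Ψc) + radialMul cB Ψc)) strip := by
    have a := contDiffOn_radialMul_Ioi hcA hDzΨ4
    have b := contDiffOn_radialMul_Ioi hcB hΨ4
    exact (a.add b).congr fun p _ => rfl
  have s1 := eHkNormSq_add_le (α := α) (k := 4) hf4 hF2
  have s2 := eHkNormSq_add_le (α := α) (k := 4) (contDiffOn_radialMul_Ioi hcA hDzΨ4) (contDiffOn_radialMul_Ioi hcB hΨ4)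
  have bA := eHkNormSq_radialMul_le α hcA (fun l hl z hz => (coef_bounds hS.pos hS.le1 hP hν1 l hl hz).1) hDzΨ4
  have bB := eHkNormSq_radialMul_le α hcB (fun l hl z hz => (coef_bounds hS.pos hS.le1 hP hν1 l hl hz).2) hΨ4
  have e4 : ENNReal.ofReal (4 * (192000 * (6 * P / ν) ^ 2)) = 2 * (2 * ENNReal.ofReal (192000 * (6 * P / ν) ^ 2)) := by
    rw [show (4 * (192000 * (6 * P / ν) ^ 2) : ℝ) = 2 * (2 * (192000 * (6 * P / ν) ^ 2)) by ring,
      ENNReal.ofReal_mul (by norm_num), ENNReal.ofReal_mul (by norm_num)]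
    simp
  rw [e4]
  calc eHkNormSq α 4 (f + (radialMul cA (Dz Ψc) + radialMul cB Ψc))
      ≤ 2 * eHkNormSq α 4 f + 2 * eHkNormSq α 4 (radialMul cA (Dz Ψc) + radialMul cB Ψc) := s1
    _ ≤ 2 * eHkNormSq α 4 f + 2 * (2 * eHkNormSq α 4 (radialMul cA (Dz Ψc)) + 2 * eHkNormSq α 4 (radialMul cB Ψc)) := by gcongr
    _ ≤ 2 * eHkNormSq α 4 f + 2 * (2 * (ENNReal.ofReal (192000 * (6 * P / ν) ^ 2) * eHkNormSq α 4 (Dz Ψc)) +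
          2 * (ENNReal.ofReal (192000 * (6 * P / ν) ^ 2) * eHkNormSq α 4 Ψc)) := by gcongr
    _ = 2 * eHkNormSq α 4 f + 2 * (2 * ENNReal.ofReal (192000 * (6 * P / ν) ^ 2)) * (eHkNormSq α 4 (Dz Ψc) + eHkNormSq α 4 Ψc) := by ring

/-! ### Pointwise convergence of the cut-off solutions on the strip -/

/-- `D_θ^iD_R^jΨ_ν → D_θ^iD_R^jΨ̃` pointwise on the strip along `ν = n + 1`. [folklore] -/
theorem tendsto_iterate_PsiN (i j : ℕ) {p : ℝ × ℝ} (hp : p ∈ strip) :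
    Tendsto (fun n : ℕ => Dθ^[i] (Dz^[j] (hS.PsiN ((n : ℝ) + 1))) p.1 p.2) atTop (𝓝 (Dθ^[i] (Dz^[j] fun R θ => Ψ (R, θ)) p.1 p.2)) := by
  have h := (tangentialFamily hS.pos hS.le1 hS.fn hS.fs hS.forth hS.sol hS.smooth hS.ae)
  have e : ∀ n : ℕ, Dθ^[i] (Dz^[j] (hS.PsiN ((n : ℝ) + 1))) p.1 p.2 = Dθ^[i] (Dz^[j] (radialMul (etaCut ((n : ℝ) + 1)) fun R θ => Ψ (R, θ))) p.1 p.2 := fun n =>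
    iterate_Dθ_Dz_congr (hS.PsiN_eq_strip (by positivity)) i j p hp
  simp_rw [e]
  exact tendsto_iterate_radialMul_etaCut h.smooth i j hp

/-- `D_θ^iD_R^j∂_θθΨ_ν → D_θ^iD_R^j∂_θθΨ̃` pointwise on the strip along `ν = n + 1`. [folklore] -/
theorem tendsto_iterate_dθdθ_PsiN (i j : ℕ) {p : ℝ × ℝ} (hp : p ∈ strip) :
    Tendsto (fun n : ℕ => Dθ^[i] (Dz^[j] (dθ (dθ (hS.PsiN ((n : ℝ) + 1))))) p.1 p.2) atTop
      (𝓝 (Dθ^[i] (Dz^[j] (dθ (dθ fun R θ => Ψ (R, θ)))) p.1 p.2)) := by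
  have h := (tangentialFamily hS.pos hS.le1 hS.fn hS.fs hS.forth hS.sol hS.smooth hS.ae)
  have hG : ContDiffOn ℝ ∞ (uncurry (dθ (dθ fun R θ => Ψ (R, θ)))) strip := contDiffOn_dθ_strip (contDiffOn_dθ_strip h.smooth)
  have e : ∀ n : ℕ, Dθ^[i] (Dz^[j] (dθ (dθ (hS.PsiN ((n : ℝ) + 1))))) p.1 p.2 =
      Dθ^[i] (Dz^[j] (radialMul (etaCut ((n : ℝ) + 1)) (dθ (dθ fun R θ => Ψ (R, θ))))) p.1 p.2 := by
    intro n
    refine iterate_Dθ_Dz_congr (fun q hq => ?_) i j p hp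
    have h2 := iterate_dθ_congr_open isOpen_strip (hS.PsiN_eq_strip (ν := (n : ℝ) + 1) (by positivity)) 2 q hq
    simp only [Function.iterate_succ_apply', Function.iterate_zero, id_eq] at h2
    rw [h2]
    have ef : dθ (dθ (radialMul (etaCut ((n : ℝ) + 1)) fun R θ => Ψ (R, θ))) = radialMul (etaCut ((n : ℝ) + 1)) (dθ (dθ fun R θ => Ψ (R, θ))) := by
      funext R θ
      have e1 : dθ (radialMul (etaCut ((n : ℝ) + 1)) fun R θ => Ψ (R, θ)) = radialMul (etaCut ((n : ℝ) + 1)) (dθ fun R θ => Ψ (R, θ)) := by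
        funext R' θ'; exact dθ_radialMul _ _ R' θ'
      rw [e1, dθ_radialMul]; rfl
    rw [ef]
  simp_rw [e]
  exact tendsto_iterate_radialMul_etaCut hG i j hp

/-- `D_θ^iD_R^j(cD_R^mF) = c·D_θ^iD_R^{j+m}F` (exact). [folklore] -/
theorem iterate_smul_iterate (c : ℝ) (F : ℝ → ℝ → ℝ) (i j m : ℕ) (z θ : ℝ) :
    Dθ^[i] (Dz^[j] (c • (Dz^[m] F))) z θ = c * Dθ^[i] (Dz^[j + m] F) z θ := by
  have := hS
  rw [iterate_Dz_smul, iterate_Dθ_smul, Function.iterate_add_apply]; rfl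

/-! ### The a-priori estimate for the solution -/

/-- The three pieces of `A(Ψ̃)` are bounded by `liminf` of the pieces of `A(Ψ_ν)`. [folklore] -/
theorem pieces_le_liminf :
    eHkNormSq α 4 (dθ (dθ fun R θ => Ψ (R, θ))) ≤ liminf (fun n : ℕ => eHkNormSq α 4 (dθ (dθ (hS.PsiN ((n : ℝ) + 1))))) atTop ∧
    eHkNormSq α 4 (α • Dz fun R θ => Ψ (R, θ)) ≤ liminf (fun n : ℕ => eHkNormSq α 4 (α • Dz (hS.PsiN ((n : ℝ) + 1)))) atTop ∧
    eHkNormSq α 4 ((α ^ 2) • (Dz^[2] fun R θ => Ψ (R, θ))) ≤ liminf (fun n : ℕ => eHkNormSq α 4 ((α ^ 2) • (Dz^[2] (hS.PsiN ((n : ℝ) + 1))))) atTop := by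
  have h := (tangentialFamily hS.pos hS.le1 hS.fn hS.fs hS.forth hS.sol hS.smooth hS.ae)
  have h4 : (4 : WithTop ℕ∞) ≤ ((⊤ : ℕ∞) : WithTop ℕ∞) := WithTop.coe_le_coe.2 le_top
  have hPs : ∀ n : ℕ, ∀ m : ℕ, ContDiff ℝ m (uncurry (hS.PsiN ((n : ℝ) + 1))) := fun n m => hS.contDiff_PsiN (by positivity) m
  refine ⟨?_, ?_, ?_⟩
  · refine eHkNormSq_le_liminf α ((contDiffOn_dθ_strip (contDiffOn_dθ_strip h.smooth)).of_le h4) (fun n => ?_) fun i j _ p hp => hS.tendsto_iterate_dθdθ_PsiN i j hp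
    exact (contDiff_dθ_of_contDiff (contDiff_dθ_of_contDiff (n := 5) (hPs n 6))).contDiffOn
  · refine eHkNormSq_le_liminf α ?_ (fun n => ?_) fun i j _ p hp => ?_
    · have := (h.smooth_iterate 1).of_le h4
      simp only [Function.iterate_one] at this
      exact (contDiffOn_const.mul this).congr fun q _ => rfl
    · have := contDiff_iterate_Dz_of_contDiff (n := 4) (m := 1) (hPs n 5)
      simp only [Function.iterate_one] at this
      exact (contDiff_const.mul this).contDiffOn.congr fun q _ => rfl
    · have e1 : ∀ F : ℝ → ℝ → ℝ, Dθ^[i] (Dz^[j] (α • Dz F)) p.1 p.2 = α * Dθ^[i] (Dz^[j + 1] F) p.1 p.2 := fun F => by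
        have := hS.iterate_smul_iterate α F i j 1 p.1 p.2; simpa using this
      simp_rw [e1]
      exact (hS.tendsto_iterate_PsiN i (j + 1) hp).const_mul α
  · refine eHkNormSq_le_liminf α ?_ (fun n => ?_) fun i j _ p hp => ?_
    · have := (h.smooth_iterate 2).of_le h4
      exact (contDiffOn_const.mul this).congr fun q _ => rfl
    · have := contDiff_iterate_Dz_of_contDiff (n := 4) (m := 2) (hPs n 6)
      exact (contDiff_const.mul this).contDiffOn.congr fun q _ => rfl
    · simp_rw [hS.iterate_smul_iterate (α ^ 2) _ i j 2]
      exact (hS.tendsto_iterate_PsiN i (j + 2) hp).const_mul (α ^ 2)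

/-- The right-hand sides converge. [folklore] -/
theorem tendsto_rhs (P : ℝ) {M : ℝ≥0∞} (hM : M ≠ ⊤) (E : ℝ≥0∞) :
    Tendsto (fun n : ℕ => aprioriC * (2 * E + ENNReal.ofReal (4 * (192000 * (6 * P / ((n : ℝ) + 1)) ^ 2)) * M)) atTop (𝓝 (aprioriC * (2 * E))) := by
  have := hS
  have h0 : Tendsto (fun n : ℕ => ENNReal.ofReal (4 * (192000 * (6 * P / ((n : ℝ) + 1)) ^ 2))) atTop (𝓝 0) := by
    have h1 : Tendsto (fun n : ℕ => 1 / ((n : ℝ) + 1)) atTop (𝓝 0) := tendsto_one_div_add_atTop_nhds_zero_nat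
    have h2 : Tendsto (fun n : ℕ => 4 * (192000 * (6 * P * (1 / ((n : ℝ) + 1))) ^ 2)) atTop (𝓝 (4 * (192000 * (6 * P * 0) ^ 2))) :=
      ((h1.const_mul (6 * P)).pow 2 |>.const_mul 192000).const_mul 4
    rw [mul_zero, zero_pow two_ne_zero, mul_zero, mul_zero] at h2
    have h3 := ENNReal.tendsto_ofReal h2
    rw [ENNReal.ofReal_zero] at h3
    refine h3.congr fun n => ?_
    congr 3; ring
  have hlim : Tendsto (fun n : ℕ => 2 * E + ENNReal.ofReal (4 * (192000 * (6 * P / ((n : ℝ) + 1)) ^ 2)) * M) atTop (𝓝 (2 * E + 0 * M)) :=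
    tendsto_const_nhds.add (ENNReal.Tendsto.mul_const h0 (Or.inr hM))
  rw [zero_mul, add_zero] at hlim
  exact ENNReal.Tendsto.const_mul hlim (Or.inr aprioriC_ne_top)

/-- **The a-priori estimate for the Lax–Milgram solution**:
`|∂_θθΨ̃|²_{𝓗⁴} + |αD_RΨ̃|²_{𝓗⁴} + |α²D_R²Ψ̃|²_{𝓗⁴} ≤ 6C₀|f|²_{𝓗⁴}`.
[cite: Elgindi2021, §7.3 proof of Proposition 7.7, Steps 2–3 and Theorem 2 (pp. 8, 21 of arXiv:1904.04795)] -/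
theorem apriori_solution : lhsA α (fun R θ => Ψ (R, θ)) ≤ 6 * aprioriC * eHkNormSq α 4 f := by
  have h := (tangentialFamily hS.pos hS.le1 hS.fn hS.fs hS.forth hS.sol hS.smooth hS.ae)
  obtain ⟨P, hP⟩ := exists_logPlateau_bound
  obtain ⟨ν₀, hν₀, hdat⟩ := hS.exists_level_datum
  set M : ℝ≥0∞ := eHkNormSq α 4 (Dz fun R θ => Ψ (R, θ)) + eHkNormSq α 4 (fun R θ => Ψ (R, θ)) with hM
  have hMfin : M ≠ ⊤ := by
    have h1 := hS.eHkNormSq_iterate_lt_top 1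
    have h0 := hS.eHkNormSq_iterate_lt_top 0
    simp only [Function.iterate_one, Function.iterate_zero, id_eq] at h1 h0
    exact ENNReal.add_ne_top.2 ⟨h1.ne, h0.ne⟩
  set E : ℝ≥0∞ := eHkNormSq α 4 f
  -- the level-`n+1` inequalities, eventually
  have hev : ∀ᶠ n : ℕ in atTop, lhsA α (hS.PsiN ((n : ℝ) + 1)) ≤ aprioriC * (2 * E + ENNReal.ofReal (4 * (192000 * (6 * P / ((n : ℝ) + 1)) ^ 2)) * M) := by
    obtain ⟨N, hN⟩ := exists_nat_ge ν₀
    filter_upwards [Filter.eventually_ge_atTop N] with n hn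
    have hνn : ν₀ ≤ (n : ℝ) + 1 := hN.trans (by exact_mod_cast Nat.le_succ_of_le hn)
    exact (hS.apriori_PsiN (by positivity)).trans (mul_le_mul_right (hS.rhs_bound hP hν₀ hdat hνn) _)
  have hT := hS.tendsto_rhs P hMfin E
  -- each piece is `≤ aprioriC * (2 * E)`
  have bound : ∀ u : ℕ → ℝ≥0∞, (∀ n, u n ≤ lhsA α (hS.PsiN ((n : ℝ) + 1))) → liminf u atTop ≤ aprioriC * (2 * E) := by
    intro u hu
    rw [← hT.liminf_eq]
    refine liminf_le_liminf ?_
    filter_upwards [hev] with n hn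
    exact (hu n).trans hn
  obtain ⟨p1, p2, p3⟩ := hS.pieces_le_liminf
  have b1 := bound (fun n : ℕ => eHkNormSq α 4 (dθ (dθ (hS.PsiN ((n : ℝ) + 1))))) fun n => by
    unfold lhsA; exact le_add_right (le_add_right le_rfl)
  have b2 := bound (fun n : ℕ => eHkNormSq α 4 (α • Dz (hS.PsiN ((n : ℝ) + 1)))) fun n => by
    unfold lhsA; exact le_add_right (le_add_left le_rfl)
  have b3 := bound (fun n : ℕ => eHkNormSq α 4 ((α ^ 2) • (Dz^[2] (hS.PsiN ((n : ℝ) + 1))))) fun n => by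
    unfold lhsA; exact le_add_left le_rfl
  unfold lhsA
  calc eHkNormSq α 4 (dθ (dθ fun R θ => Ψ (R, θ))) + eHkNormSq α 4 (α • Dz fun R θ => Ψ (R, θ)) + eHkNormSq α 4 ((α ^ 2) • (Dz^[2] fun R θ => Ψ (R, θ)))
      ≤ aprioriC * (2 * E) + aprioriC * (2 * E) + aprioriC * (2 * E) := add_le_add (add_le_add (p1.trans b1) (p2.trans b2)) (p3.trans b3)
    _ = 6 * aprioriC * E := by ring

end SolData

end Elgindi

end Literature.Analysis.FluidPDE
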